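import Summits.AtomisticToContinuum.Crystallization.Theorems.ReggeStarCoercivityDefectFreeCrystallizesProcrustesAux

/-!
# Route `ReggeStarCoercivity`, crux `DefectFreeCrystallizes` (stmt-AtomisticToContinuum-13603), line `palm-good-law` (v38):
# the engine tool `stub_procrustes` — LOCAL QUANTITATIVE RIGIDITY OF A SPANNING POINT CONFIGURATION

**Theorem** (`stub_procrustes`).  For `n` reference points `p i` of `ℝ³` whose frame is non-degenerate
(`Σ_i ⟪p i, x⟫² ≥ m ‖x‖²`, `m > 0`) and bounded (`Σ_i ‖p i‖² ≤ M`) there are constants `C, ρ > 0` depending only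
on `(n, m, M)` such that every configuration `y` whose rooted Gram data (squared norms `‖y i‖²` and squared mutual
distances `‖y i − y j‖²`) is `ρ`-close to that of `p` is, after a linear isometry `A` of `ℝ³`, close to `p` in
position: `Σ_i ‖A (p i) − y i‖² ≤ C · (Σ_i (‖y i‖² − ‖p i‖²)² + Σ_i Σ_j (‖y i − y j‖² − ‖p i − p j‖²)²)`.
Explicitly `C = 2 (n+1) (1680 μ² M + 48 μ n) + 1`, `ρ = 1 / (80000 (n+1) (μ² + 1))`, `μ = M / m²`.

**Proof** (elementary linear algebra, no SVD / polar decomposition; proved for an abstract real inner product space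
`E` with an orthonormal basis `e` indexed by `Fin 3` — `procrustes_core` — then specialised to
`EuclideanSpace ℝ (Fin 3)`; the generic lemmas are in `…DefectFreeCrystallizesProcrustesAux`).
* Polarisation (`gram_sq_le_data`): `G := Σ_{ij} (⟪y i, y j⟫ − ⟪p i, p j⟫)² ≤ 2 (n+1) · DATA`.
* `exists_frame_coeffs` (canonical dual frame): the frame operator `S x = Σ ⟪p i, x⟫ p i` is injective by the frame
  bound, hence surjective (finite dimension); solving `S w_k = e k` gives `e k = Σ_i c_{ki} p i` with
  `c_{ki} = ⟪p i, w_k⟫`, `‖w_k‖ ≤ 1/m`, so `Σ_i c_{ki}² ≤ μ`.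
* With `γ_i(z) := Σ_k ⟪e k, z⟫ c_{ki}`: `z = Σ_i γ_i(z) p i`, `Σ_i γ_i(z)² ≤ 3 μ ‖z‖²`; the linear fit
  `L z := Σ_i γ_i(z) y i = Σ_k ⟪e k, z⟫ v_k`, `v_k := Σ_i c_{ki} y i`; by the pairing estimate (`pairing_sq_le`) the
  Gram matrix of `(v_k)` is `η`-close to the identity with `η² = μ² G ≤ (1/200)²` once `DATA ≤ ρ`.
* `exists_isometry_near` (quantitative Gram–Schmidt): a linear isometry `A` with `‖A z − L z‖² ≤ 768 η² ‖z‖² ≤ ‖z‖²/4`.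
* Residual `E_a := y a − L (p a) = Σ_i α_i y i`, `α = δ_a − γ(p a)`, `Σ α_i p i = 0`: the pairing estimate with
  `β = γ(z)`, `z := A⁻¹ E_a`, gives `⟪E_a, L z⟫² ≤ (2 + 6 μ ‖p a‖²)(3 μ ‖E_a‖²) G`, while
  `⟪E_a, L z⟫ ≥ ‖E_a‖² − ‖E_a‖ ‖A z − L z‖ ≥ ‖E_a‖²/2`; hence `‖E_a‖² ≤ (24 μ + 72 μ² ‖p a‖²) G`.
* Finally `‖A (p a) − y a‖² ≤ 2 ‖A (p a) − L (p a)‖² + 2 ‖E_a‖²`, summed over `a`, and `G ≤ 2 (n+1) DATA`.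
All `[folklore]`; no definitions, Mathlib only.
-/

noncomputable section

open scoped BigOperators RealInnerProductSpace

namespace Summit.AtomisticToContinuum.Crystallization.Theorems.PalmGoodLaw.Procrustes

variable {E : Type*} [NormedAddCommGroup E] [InnerProductSpace ℝ E]

/-- **Bounded dual-frame coefficients.**  A frame `p` of `E` with lower frame bound `m` and
`Σ ‖p i‖² ≤ M` expresses every basis vector `e k` as `Σ_i c_{ki} p i` with `Σ_i c_{ki}² ≤ M / m²`
(canonical dual frame). [folklore] -/
theorem exists_frame_coeffs [FiniteDimensional ℝ E] (e : OrthonormalBasis (Fin 3) ℝ E) {n : ℕ}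
    {m M : ℝ} (hm : 0 < m) (p : Fin n → E)
    (hframe : ∀ x : E, m * ‖x‖ ^ 2 ≤ ∑ i, ⟪p i, x⟫ ^ 2) (hbdd : ∑ i, ‖p i‖ ^ 2 ≤ M) :
    ∃ c : Fin 3 → Fin n → ℝ, (∀ k, ∑ i, c k i • p i = e k) ∧ ∀ k, ∑ i, c k i ^ 2 ≤ M / m ^ 2 := by
  let S : E →ₗ[ℝ] E := ∑ i, (innerₗ E (p i)).smulRight (p i)
  have hS : ∀ x, S x = ∑ i, ⟪p i, x⟫ • p i := fun x => by
    simp only [S, LinearMap.sum_apply, LinearMap.smulRight_apply, innerₗ_apply_apply]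
  have hSinner : ∀ x w, ⟪S x, w⟫ = ∑ i, ⟪p i, x⟫ * ⟪p i, w⟫ := fun x w => by
    rw [hS, sum_inner]; simp_rw [real_inner_smul_left]
  have hSsq : ∀ x, ⟪S x, x⟫ = ∑ i, ⟪p i, x⟫ ^ 2 := fun x => by
    rw [hSinner]; simp_rw [sq]
  have hSinj : Function.Injective S := by
    rw [← LinearMap.ker_eq_bot, LinearMap.ker_eq_bot']
    intro x hx
    have h1 := hframe x
    rw [← hSsq, hx, inner_zero_left] at h1
    have h2 : ‖x‖ ^ 2 ≤ 0 := by
      by_contra hc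
      have hc' : 0 < ‖x‖ ^ 2 := lt_of_not_ge hc
      linarith [mul_pos hm hc']
    have h3 : ‖x‖ ^ 2 = 0 := le_antisymm h2 (sq_nonneg _)
    exact norm_eq_zero.mp ((pow_eq_zero_iff two_ne_zero).mp h3)
  have hSsurj : Function.Surjective S := LinearMap.injective_iff_surjective.mp hSinj
  choose w hw using fun k => hSsurj (e k)
  have hwn : ∀ k, ‖w k‖ * m ≤ 1 := fun k => by
    have h1 : m * ‖w k‖ ^ 2 ≤ ‖w k‖ :=
      calc m * ‖w k‖ ^ 2 ≤ ∑ i, ⟪p i, w k⟫ ^ 2 := hframe (w k)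
        _ = ⟪S (w k), w k⟫ := (hSsq (w k)).symm
        _ = ⟪e k, w k⟫ := by rw [hw]
        _ ≤ ‖e k‖ * ‖w k‖ := real_inner_le_norm _ _
        _ = ‖w k‖ := by rw [e.norm_eq_one, one_mul]
    rcases (norm_nonneg (w k)).eq_or_lt with h0 | hpos
    · rw [← h0, zero_mul]; exact zero_le_one
    · nlinarith
  have hM : 0 ≤ M := (Finset.sum_nonneg fun i _ => sq_nonneg _).trans hbdd
  refine ⟨fun k i => ⟪p i, w k⟫, fun k => by rw [← hw k, hS], fun k => ?_⟩
  calc ∑ i, ⟪p i, w k⟫ ^ 2 ≤ ∑ i, ‖p i‖ ^ 2 * ‖w k‖ ^ 2 := by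
        refine Finset.sum_le_sum fun i _ => ?_
        rw [← mul_pow, ← sq_abs]
        exact pow_le_pow_left₀ (abs_nonneg _) (abs_real_inner_le_norm _ _) 2
    _ = (∑ i, ‖p i‖ ^ 2) * ‖w k‖ ^ 2 := (Finset.sum_mul ..).symm
    _ ≤ M * (1 / m) ^ 2 :=
        mul_le_mul hbdd
          (pow_le_pow_left₀ (norm_nonneg _) (by rw [le_div_iff₀ hm]; exact hwn k) 2)
          (sq_nonneg _) hM
    _ = M / m ^ 2 := by rw [one_div, inv_pow, div_eq_mul_inv]

/-- **Local quantitative rigidity, abstract form** (any real inner product space with an orthonormal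
basis indexed by `Fin 3`).  See `stub_procrustes`. [folklore] -/
theorem procrustes_core [FiniteDimensional ℝ E] (e : OrthonormalBasis (Fin 3) ℝ E) (n : ℕ)
    (m M : ℝ) (hm : 0 < m) (hM : 0 ≤ M) :
    ∃ C ρ : ℝ, 0 < C ∧ 0 < ρ ∧
      ∀ p : Fin n → E, (∀ x : E, m * ‖x‖ ^ 2 ≤ ∑ i, ⟪p i, x⟫ ^ 2) → (∑ i, ‖p i‖ ^ 2 ≤ M) →
        ∀ y : Fin n → E,
          (∑ i, (‖y i‖ ^ 2 - ‖p i‖ ^ 2) ^ 2 +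
              ∑ i, ∑ j, (‖y i - y j‖ ^ 2 - ‖p i - p j‖ ^ 2) ^ 2 ≤ ρ) →
          ∃ A : E ≃ₗᵢ[ℝ] E, ∑ i, ‖A (p i) - y i‖ ^ 2 ≤
            C * (∑ i, (‖y i‖ ^ 2 - ‖p i‖ ^ 2) ^ 2 +
              ∑ i, ∑ j, (‖y i - y j‖ ^ 2 - ‖p i - p j‖ ^ 2) ^ 2) := by
  obtain ⟨μ, hμdef⟩ : ∃ μ : ℝ, μ = M / m ^ 2 := ⟨_, rfl⟩
  have hμ : 0 ≤ μ := by rw [hμdef]; positivity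
  have hn0 : (0 : ℝ) ≤ n := Nat.cast_nonneg n
  refine ⟨2 * (n + 1) * (1680 * μ ^ 2 * M + 48 * μ * n) + 1,
    1 / (80000 * (n + 1) * (μ ^ 2 + 1)), by positivity, by positivity, ?_⟩
  intro p hframe hbdd y hdata
  -- the data `D` and the squared Gram deviation `G`
  obtain ⟨D, hDdef⟩ : ∃ D : ℝ, D = ∑ i, (‖y i‖ ^ 2 - ‖p i‖ ^ 2) ^ 2 +
      ∑ i, ∑ j, (‖y i - y j‖ ^ 2 - ‖p i - p j‖ ^ 2) ^ 2 := ⟨_, rfl⟩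
  obtain ⟨G, hGdef⟩ : ∃ G : ℝ, G = ∑ i, ∑ j, (⟪y i, y j⟫ - ⟪p i, p j⟫) ^ 2 := ⟨_, rfl⟩
  rw [← hDdef] at hdata ⊢
  have hD0 : 0 ≤ D := hDdef ▸ add_nonneg (Finset.sum_nonneg fun _ _ => sq_nonneg _)
    (Finset.sum_nonneg fun _ _ => Finset.sum_nonneg fun _ _ => sq_nonneg _)
  have hG0 : 0 ≤ G := hGdef ▸ Finset.sum_nonneg fun _ _ => Finset.sum_nonneg fun _ _ => sq_nonneg _
  have hGD : G ≤ 2 * (n + 1) * D := by rw [hGdef, hDdef]; exact gram_sq_le_data p y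
  -- bounded dual-frame coefficients and the coordinate functionals `γ`
  obtain ⟨c, hc_rep, hc_sq⟩ := exists_frame_coeffs e hm p hframe hbdd
  have hc_sq' : ∀ k, ∑ i, c k i ^ 2 ≤ μ := fun k => by rw [hμdef]; exact hc_sq k
  obtain ⟨γ, hγdef⟩ : ∃ γ : E → Fin n → ℝ, γ = fun z i => ∑ k, ⟪e k, z⟫ * c k i := ⟨_, rfl⟩
  have hγ_rep : ∀ z, ∑ i, γ z i • p i = z := fun z => by
    rw [hγdef]
    show ∑ i, (∑ k, ⟪e k, z⟫ * c k i) • p i = z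
    rw [sum_sum_mul_smul]
    simp_rw [hc_rep]
    exact e.sum_repr' z
  have hγ_sq : ∀ z, ∑ i, γ z i ^ 2 ≤ 3 * μ * ‖z‖ ^ 2 := fun z => by
    rw [hγdef]
    show ∑ i, (∑ k, ⟪e k, z⟫ * c k i) ^ 2 ≤ _
    calc ∑ i, (∑ k, ⟪e k, z⟫ * c k i) ^ 2 ≤ ∑ i, (∑ k, ⟪e k, z⟫ ^ 2) * ∑ k, c k i ^ 2 :=
          Finset.sum_le_sum fun i _ => Finset.sum_mul_sq_le_sq_mul_sq _ _ _
      _ = ‖z‖ ^ 2 * ∑ k, ∑ i, c k i ^ 2 := by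
          rw [← Finset.mul_sum, e.sum_sq_inner_right, Finset.sum_comm]
      _ ≤ ‖z‖ ^ 2 * ∑ _k : Fin 3, μ :=
          mul_le_mul_of_nonneg_left (Finset.sum_le_sum fun k _ => hc_sq' k) (sq_nonneg _)
      _ = 3 * μ * ‖z‖ ^ 2 := by
          simp only [Finset.sum_const, Finset.card_univ, Fintype.card_fin, nsmul_eq_mul]; ring
  -- the near-orthonormal triple `v` and the linear fit `L`
  obtain ⟨v, hvdef⟩ : ∃ v : Fin 3 → E, v = fun k => ∑ i, c k i • y i := ⟨_, rfl⟩
  obtain ⟨L, hLdef⟩ : ∃ L : E → E, L = fun z => ∑ i, γ z i • y i := ⟨_, rfl⟩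
  have hL : ∀ z, L z = ∑ k, ⟪e k, z⟫ • v k := fun z => by
    rw [hLdef, hvdef, hγdef]
    exact sum_sum_mul_smul (fun k => ⟪e k, z⟫) c y
  have hv : ∀ k l, (⟪v k, v l⟫ - (if k = l then 1 else 0)) ^ 2 ≤ μ ^ 2 * G := fun k l => by
    have hkl : (if k = l then (1 : ℝ) else 0) = ⟪e k, e l⟫ :=
      (orthonormal_iff_ite.mp e.orthonormal k l).symm
    rw [hkl, ← hc_rep k, ← hc_rep l, hvdef, hGdef]
    calc _ ≤ (∑ i, c k i ^ 2) * (∑ j, c l j ^ 2) * ∑ i, ∑ j, (⟪y i, y j⟫ - ⟪p i, p j⟫) ^ 2 :=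
          pairing_sq_le p y (c k) (c l)
      _ ≤ μ * μ * ∑ i, ∑ j, (⟪y i, y j⟫ - ⟪p i, p j⟫) ^ 2 := by
          refine mul_le_mul_of_nonneg_right ?_ (hGdef ▸ hG0)
          exact mul_le_mul (hc_sq' k) (hc_sq' l) (Finset.sum_nonneg fun _ _ => sq_nonneg _) hμ
      _ = μ ^ 2 * _ := by ring
  -- the size `η` of the Gram perturbation
  obtain ⟨η, hηdef⟩ : ∃ η : ℝ, η = Real.sqrt (μ ^ 2 * G) := ⟨_, rfl⟩
  have hηsq : η ^ 2 = μ ^ 2 * G := by rw [hηdef]; exact Real.sq_sqrt (by positivity)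
  have hμG : μ ^ 2 * G ≤ (1 / 200) ^ 2 := by
    have hQ : (0 : ℝ) < 80000 * (n + 1) * (μ ^ 2 + 1) := by positivity
    have h1 : μ ^ 2 * G ≤ μ ^ 2 * (2 * (n + 1) * (1 / (80000 * (n + 1) * (μ ^ 2 + 1)))) :=
      mul_le_mul_of_nonneg_left (hGD.trans (mul_le_mul_of_nonneg_left hdata (by positivity)))
        (sq_nonneg μ)
    have h2 : μ ^ 2 * (2 * (n + 1) * (1 / (80000 * (n + 1) * (μ ^ 2 + 1)))) ≤ (1 / 200) ^ 2 := by
      rw [mul_one_div, ← mul_div_assoc, div_le_iff₀ hQ]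
      nlinarith [sq_nonneg μ]
    exact h1.trans h2
  have hη : η ≤ 1 / 200 := by
    rw [hηdef]; exact (Real.sqrt_le_sqrt hμG).trans_eq (Real.sqrt_sq (by norm_num))
  have hvη : ∀ k l, |⟪v k, v l⟫ - (if k = l then 1 else 0)| ≤ η := fun k l => by
    rw [hηdef]; exact Real.abs_le_sqrt (hv k l)
  -- the isometry
  obtain ⟨A, hA⟩ := exists_isometry_near e v hη hvη
  have hAL : ∀ z, ‖A z - L z‖ ^ 2 ≤ 768 * η ^ 2 * ‖z‖ ^ 2 := fun z => by rw [hL]; exact hA z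
  have hAL' : ∀ z, ‖A z - L z‖ ≤ ‖z‖ / 2 := fun z => by
    have h768 : 768 * η ^ 2 ≤ 1 / 4 := by rw [hηsq]; linarith
    have h1 : ‖A z - L z‖ ^ 2 ≤ (‖z‖ / 2) ^ 2 :=
      (hAL z).trans (by nlinarith [sq_nonneg ‖z‖])
    exact le_of_pow_le_pow_left₀ two_ne_zero (by positivity) h1
  refine ⟨A, ?_⟩
  -- the residual of the linear fit
  have hE : ∀ a, ‖y a - L (p a)‖ ^ 2 ≤ (24 * μ + 72 * μ ^ 2 * ‖p a‖ ^ 2) * G := fun a => by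
    obtain ⟨Ea, hEa⟩ : ∃ Ea : E, Ea = y a - L (p a) := ⟨_, rfl⟩
    rw [← hEa]
    obtain ⟨z, hz⟩ : ∃ z : E, z = A.symm Ea := ⟨_, rfl⟩
    have hzn : ‖z‖ = ‖Ea‖ := by rw [hz, LinearIsometryEquiv.norm_map]
    have hAz : A z = Ea := by rw [hz, LinearIsometryEquiv.apply_symm_apply]
    obtain ⟨α, hα⟩ : ∃ α : Fin n → ℝ, α = fun i => (if i = a then 1 else 0) - γ (p a) i :=
      ⟨_, rfl⟩
    have hαy : ∑ i, α i • y i = Ea := by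
      rw [hα, hEa, hLdef]
      show ∑ i, ((if i = a then (1 : ℝ) else 0) - γ (p a) i) • y i = y a - ∑ i, γ (p a) i • y i
      simp only [sub_smul, Finset.sum_sub_distrib, ite_smul, one_smul, zero_smul,
        Fintype.sum_ite_eq']
    have hαp : ∑ i, α i • p i = 0 := by
      rw [hα]
      show ∑ i, ((if i = a then (1 : ℝ) else 0) - γ (p a) i) • p i = 0
      simp only [sub_smul, Finset.sum_sub_distrib, ite_smul, one_smul, zero_smul,
        Fintype.sum_ite_eq']
      rw [hγ_rep (p a), sub_self]
    have hαsq : ∑ i, α i ^ 2 ≤ 2 + 6 * μ * ‖p a‖ ^ 2 := by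
      have h1 : ∀ i, α i ^ 2 ≤ 2 * (if i = a then 1 else 0) + 2 * γ (p a) i ^ 2 := fun i => by
        rw [hα]
        by_cases hi : i = a
        · simp only [hi, if_true]; nlinarith [sq_nonneg (1 + γ (p a) a)]
        · simp only [hi, if_false]; nlinarith
      calc ∑ i, α i ^ 2 ≤ ∑ i, (2 * (if i = a then 1 else 0) + 2 * γ (p a) i ^ 2) :=
            Finset.sum_le_sum fun i _ => h1 i
        _ = 2 + 2 * ∑ i, γ (p a) i ^ 2 := by
            rw [Finset.sum_add_distrib, ← Finset.mul_sum, ← Finset.mul_sum]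
            simp only [Finset.sum_ite_eq', Finset.mem_univ, if_true, mul_one]
        _ ≤ 2 + 2 * (3 * μ * ‖p a‖ ^ 2) := by linarith [hγ_sq (p a)]
        _ = 2 + 6 * μ * ‖p a‖ ^ 2 := by ring
    have hLz : ∑ j, γ z j • y j = L z := by rw [hLdef]
    have hpair := pairing_sq_le p y α (γ z)
    rw [hαy, hαp, hγ_rep z, hLz, inner_zero_left, sub_zero, ← hGdef] at hpair
    have hinner : ‖Ea‖ ^ 2 / 2 ≤ ⟪Ea, L z⟫ := by
      have h1 : ‖Ea‖ ^ 2 = ⟪Ea, L z⟫ + ⟪Ea, A z - L z⟫ := by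
        rw [← inner_add_right, add_sub_cancel, hAz, real_inner_self_eq_norm_sq]
      have h2 : ⟪Ea, A z - L z⟫ ≤ ‖Ea‖ ^ 2 / 2 :=
        calc ⟪Ea, A z - L z⟫ ≤ ‖Ea‖ * ‖A z - L z‖ := real_inner_le_norm _ _
          _ ≤ ‖Ea‖ * (‖Ea‖ / 2) :=
              mul_le_mul_of_nonneg_left ((hAL' z).trans_eq (by rw [hzn])) (norm_nonneg _)
          _ = ‖Ea‖ ^ 2 / 2 := by ring
      linarith
    have hK : ⟪Ea, L z⟫ ^ 2 ≤ (2 + 6 * μ * ‖p a‖ ^ 2) * (3 * μ) * G * ‖Ea‖ ^ 2 :=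
      calc ⟪Ea, L z⟫ ^ 2 ≤ (∑ i, α i ^ 2) * (∑ j, γ z j ^ 2) * G := hpair
        _ ≤ (2 + 6 * μ * ‖p a‖ ^ 2) * (3 * μ * ‖z‖ ^ 2) * G :=
            mul_le_mul_of_nonneg_right
              (mul_le_mul hαsq (hγ_sq z) (Finset.sum_nonneg fun _ _ => sq_nonneg _)
                (by positivity)) hG0
        _ = (2 + 6 * μ * ‖p a‖ ^ 2) * (3 * μ) * G * ‖Ea‖ ^ 2 := by rw [hzn]; ring
    have h4 := le_four_mul_of_sq_half_le (t := ‖Ea‖ ^ 2)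
      (K := (2 + 6 * μ * ‖p a‖ ^ 2) * (3 * μ) * G) (by positivity)
      ((pow_le_pow_left₀ (by positivity) hinner 2).trans hK)
    calc ‖Ea‖ ^ 2 ≤ 4 * ((2 + 6 * μ * ‖p a‖ ^ 2) * (3 * μ) * G) := h4
      _ = (24 * μ + 72 * μ ^ 2 * ‖p a‖ ^ 2) * G := by ring
  -- summing up
  have hterm : ∀ a, ‖A (p a) - y a‖ ^ 2 ≤
      2 * (768 * η ^ 2 * ‖p a‖ ^ 2) + 2 * ((24 * μ + 72 * μ ^ 2 * ‖p a‖ ^ 2) * G) := fun a => by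
    have h1 : A (p a) - y a = (A (p a) - L (p a)) - (y a - L (p a)) := by abel
    rw [h1]
    calc ‖(A (p a) - L (p a)) - (y a - L (p a))‖ ^ 2
        ≤ (‖A (p a) - L (p a)‖ + ‖y a - L (p a)‖) ^ 2 :=
          pow_le_pow_left₀ (norm_nonneg _) (norm_sub_le _ _) 2
      _ ≤ 2 * ‖A (p a) - L (p a)‖ ^ 2 + 2 * ‖y a - L (p a)‖ ^ 2 := by
          nlinarith [sq_nonneg (‖A (p a) - L (p a)‖ - ‖y a - L (p a)‖)]
      _ ≤ 2 * (768 * η ^ 2 * ‖p a‖ ^ 2) + 2 * ((24 * μ + 72 * μ ^ 2 * ‖p a‖ ^ 2) * G) :=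
          add_le_add (mul_le_mul_of_nonneg_left (hAL (p a)) zero_le_two)
            (mul_le_mul_of_nonneg_left (hE a) zero_le_two)
  have hcoef : 0 ≤ 1536 * η ^ 2 + 144 * μ ^ 2 * G := by positivity
  calc ∑ a, ‖A (p a) - y a‖ ^ 2
      ≤ ∑ a, (2 * (768 * η ^ 2 * ‖p a‖ ^ 2) + 2 * ((24 * μ + 72 * μ ^ 2 * ‖p a‖ ^ 2) * G)) :=
        Finset.sum_le_sum fun a _ => hterm a
    _ = ∑ a, ((1536 * η ^ 2 + 144 * μ ^ 2 * G) * ‖p a‖ ^ 2 + 48 * μ * G) :=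
        Finset.sum_congr rfl fun a _ => by ring
    _ = (1536 * η ^ 2 + 144 * μ ^ 2 * G) * ∑ a, ‖p a‖ ^ 2 + n * (48 * μ * G) := by
        rw [Finset.sum_add_distrib, ← Finset.mul_sum, Finset.sum_const, Finset.card_univ,
          Fintype.card_fin, nsmul_eq_mul]
    _ ≤ (1536 * η ^ 2 + 144 * μ ^ 2 * G) * M + n * (48 * μ * G) := by
        have := mul_le_mul_of_nonneg_left hbdd hcoef
        linarith
    _ = (1680 * μ ^ 2 * M + 48 * μ * n) * G := by rw [hηsq]; ring
    _ ≤ (1680 * μ ^ 2 * M + 48 * μ * n) * (2 * (n + 1) * D) :=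
        mul_le_mul_of_nonneg_left hGD (by positivity)
    _ ≤ (2 * (n + 1) * (1680 * μ ^ 2 * M + 48 * μ * n) + 1) * D := by
        have : (2 * (n + 1) * (1680 * μ ^ 2 * M + 48 * μ * n) + 1) * D =
            (1680 * μ ^ 2 * M + 48 * μ * n) * (2 * (n + 1) * D) + D := by ring
        linarith

/-- **`stub_procrustes` — LOCAL QUANTITATIVE RIGIDITY OF A SPANNING POINT CONFIGURATION** (engine tool of line
`palm-good-law`, v38; registered signature).  For `n` reference points `p i` of `ℝ³` whose frame is non-degenerate
(`Σ_i ⟪p i, x⟫² ≥ m‖x‖²`) and bounded (`Σ_i ‖p i‖² ≤ M`) there are constants `C, ρ > 0` depending only on `(n, m, M)`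
such that every configuration `y` whose rooted Gram data — squared norms `‖y i‖²` and squared mutual distances
`‖y i − y j‖²` — is `ρ`-close to the reference is, after a linear isometry `A` of `ℝ³`, close to the reference in
position: `Σ_i ‖A (p i) − y i‖² ≤ C · (Σ_i (‖y i‖² − ‖p i‖²)² + Σ_i Σ_j (‖y i − y j‖² − ‖p i − p j‖²)²)`.
This dominates the κ-CORE's congruence defect `starDefect` by the squared-distance deviations `δs` in which cluster
certificates are written.  Proof: `procrustes_core` with the standard basis of `EuclideanSpace ℝ (Fin 3)`. [folklore] -/
theorem stub_procrustes :
    ∀ (n : ℕ) (m M : ℝ), 0 < m → 0 ≤ M → ∃ C ρ : ℝ, 0 < C ∧ 0 < ρ ∧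
      ∀ p : Fin n → EuclideanSpace ℝ (Fin 3),
        (∀ x : EuclideanSpace ℝ (Fin 3), m * ‖x‖ ^ 2 ≤ ∑ i, inner ℝ (p i) x ^ 2) →
        (∑ i, ‖p i‖ ^ 2 ≤ M) →
        ∀ y : Fin n → EuclideanSpace ℝ (Fin 3),
          (∑ i, (‖y i‖ ^ 2 - ‖p i‖ ^ 2) ^ 2 + ∑ i, ∑ j, (‖y i - y j‖ ^ 2 - ‖p i - p j‖ ^ 2) ^ 2 ≤ ρ) →
          ∃ A : EuclideanSpace ℝ (Fin 3) ≃ₗᵢ[ℝ] EuclideanSpace ℝ (Fin 3),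
            ∑ i, ‖A (p i) - y i‖ ^ 2 ≤
              C * (∑ i, (‖y i‖ ^ 2 - ‖p i‖ ^ 2) ^ 2 + ∑ i, ∑ j, (‖y i - y j‖ ^ 2 - ‖p i - p j‖ ^ 2) ^ 2) := by
  intro n m M hm hM
  exact procrustes_core (EuclideanSpace.basisFun (Fin 3) ℝ) n m M hm hM

end Summit.AtomisticToContinuum.Crystallization.Theorems.PalmGoodLaw.Procrustes

end
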